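import Literature.Analysis.Complex.RealEnvironment
import Literature.Analysis.Complex.OsgoodProofs
import Mathlib.Analysis.LocallyConvex.WithSeminorms
import Mathlib.Topology.Connected.LocallyConnected
import HarnessLib

/-!
# Identity theorem from a real ball to a convex real chamber (E1-locality toolkit, stub `stub_locality`)

Helper file for stub `stub_locality` of crux `OSLegsAtWeakCouplingC` (stmt-QuantumFields-16207, line `Sketch`).
In the locality argument the defect of an `m`-point Schwinger function under a planar rotation, evaluated on
product bumps centred at a configuration `x ∈ (ℝ⁴)ᵐ`, is the restriction to real points of a function `Φ`
holomorphic on an open complex neighbourhood `V ⊆ (ℂ⁴)ᵐ` of a CONVEX real chamber `C` (fixed coordinate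
orderings); it vanishes near one configuration `x₀ ∈ C` and `eqOn_convex_of_eqOn_ball` propagates the vanishing
to all of `C`:

* the connected component `U` of `V` containing the real point `x₀` is open (normed spaces are locally
  connected), preconnected, and contains the image of `C` under the entrywise real embedding (a connected subset
  of `V` through `x₀`);
* `Φ` is analytic on `U` (Osgood's lemma, `Literature.Analysis.Complex.SCV.analyticOnNhd_of_differentiableOn`);
* the real points of a small complex ball about `x₀` lie in the real ball `Metric.ball x₀ δ` (the sup norms of
  `ℝ^{m×4}` and `ℂ^{m×4}` agree on real points), so `Φ` vanishes there, and the global real-environment identity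
  theorem `Literature.Analysis.Complex.SCV.eqOn_zero_of_eq_zero_on_reals_pi₂` (Streater–Wightman §2-3) gives
  `Φ = 0` on `U ⊇ C`.

Refs: StreaterWightman1964 §2-3, §2-4; HormanderSCV1973 Thm. 2.2.1, 2.2.6.
-/

noncomputable section

open Set Metric Topology

namespace Summit.QuantumFields.YangMills.Theorems.OSLegsAtWeakCouplingC

/-- The entrywise real embedding `ℝ^{m×4} → ℂ^{m×4}` is continuous. -/
private theorem continuous_ofReal_pi₂ (m : ℕ) :
    Continuous (fun (x : Fin m → Fin 4 → ℝ) (i : Fin m) (μ : Fin 4) => ((x i μ : ℝ) : ℂ)) := by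
  fun_prop

/-- The sup norm of a real configuration is dominated by (in fact equal to) the sup norm of its image under
the entrywise real embedding: `‖w − x₀‖ ≤ ‖ι w − ι x₀‖`. -/
private theorem norm_sub_le_norm_ofReal_sub {m : ℕ} (w x₀ : Fin m → Fin 4 → ℝ) :
    ‖w - x₀‖ ≤ ‖(fun i μ => ((w i μ : ℝ) : ℂ)) - (fun i μ => ((x₀ i μ : ℝ) : ℂ))‖ := by
  refine (pi_norm_le_iff_of_nonneg (norm_nonneg _)).2 fun i => ?_
  refine (pi_norm_le_iff_of_nonneg (norm_nonneg _)).2 fun μ => ?_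
  calc ‖(w - x₀) i μ‖
        = ‖((fun i μ => ((w i μ : ℝ) : ℂ)) - (fun i μ => ((x₀ i μ : ℝ) : ℂ))) i μ‖ := by
          simp only [Pi.sub_apply, ← Complex.ofReal_sub, Complex.norm_real]
    _ ≤ ‖((fun i μ => ((w i μ : ℝ) : ℂ)) - (fun i μ => ((x₀ i μ : ℝ) : ℂ))) i‖ := norm_le_pi_norm _ μ
    _ ≤ _ := norm_le_pi_norm _ i

/-- **Identity theorem from a real ball to a convex real chamber** (several complex variables).  Let `Φ` be
holomorphic on an open set `V ⊆ (ℂ⁴)ᵐ` containing the real points of a convex set `C ⊆ (ℝ⁴)ᵐ`.  If `Φ` vanishes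
at the real points of a ball `Metric.ball x₀ δ ⊆ C`, then `Φ` vanishes at every real point of `C`.  Proof: the
connected component `U` of `V` through `x₀` is open, preconnected, contains the (connected) image of `C`, and `Φ`
is analytic on it (Osgood); the real-environment identity theorem
`Literature.Analysis.Complex.SCV.eqOn_zero_of_eq_zero_on_reals_pi₂` on `U` concludes. -/
theorem eqOn_convex_of_eqOn_ball : ∀ {m : ℕ} {V : Set (Fin m → Fin 4 → ℂ)}, IsOpen V → ∀ {Φ : (Fin m → Fin 4 → ℂ) → ℂ}, DifferentiableOn ℂ Φ V → ∀ {C : Set (Fin m → Fin 4 → ℝ)}, Convex ℝ C → (∀ x ∈ C, (fun i μ => ((x i μ : ℝ) : ℂ)) ∈ V) → ∀ {x₀ : Fin m → Fin 4 → ℝ} {δ : ℝ}, 0 < δ → Metric.ball x₀ δ ⊆ C → (∀ x ∈ Metric.ball x₀ δ, Φ (fun i μ => ((x i μ : ℝ) : ℂ)) = 0) → ∀ x ∈ C, Φ (fun i μ => ((x i μ : ℝ) : ℂ)) = 0 := by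
  intro m V hV Φ hΦ C hC hCV x₀ δ hδ hball h0 x hx
  have hx₀C : x₀ ∈ C := hball (mem_ball_self hδ)
  -- the connected component `U` of `V` through the real point `x₀`
  have hUo : IsOpen (connectedComponentIn V (fun i μ => ((x₀ i μ : ℝ) : ℂ))) := hV.connectedComponentIn
  have hUV : connectedComponentIn V (fun i μ => ((x₀ i μ : ℝ) : ℂ)) ⊆ V := connectedComponentIn_subset _ _
  have hUc : IsPreconnected (connectedComponentIn V (fun i μ => ((x₀ i μ : ℝ) : ℂ))) :=
    isPreconnected_connectedComponentIn
  -- the real points of `C` lie in `U`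
  have hCU : (fun (x : Fin m → Fin 4 → ℝ) (i : Fin m) (μ : Fin 4) => ((x i μ : ℝ) : ℂ)) '' C ⊆
      connectedComponentIn V (fun i μ => ((x₀ i μ : ℝ) : ℂ)) := by
    refine IsPreconnected.subset_connectedComponentIn ?_ (mem_image_of_mem _ hx₀C) ?_
    · exact hC.isPreconnected.image _ (continuous_ofReal_pi₂ m).continuousOn
    · rintro _ ⟨y, hy, rfl⟩
      exact hCV y hy
  -- `Φ` is analytic on `U` (Osgood)
  have hΦU : AnalyticOnNhd ℂ Φ (connectedComponentIn V (fun i μ => ((x₀ i μ : ℝ) : ℂ))) :=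
    Literature.Analysis.Complex.SCV.analyticOnNhd_of_differentiableOn (hΦ.mono hUV) hUo
  -- a small complex ball about `x₀` inside `U` whose real points lie in `Metric.ball x₀ δ`
  obtain ⟨ε, hε, hεU⟩ := Metric.isOpen_iff.1 hUo _ (hCU (mem_image_of_mem _ hx₀C))
  have hρ : 0 < min ε δ := lt_min hε hδ
  have hsub : ball (fun i μ => ((x₀ i μ : ℝ) : ℂ)) (min ε δ) ⊆
      connectedComponentIn V (fun i μ => ((x₀ i μ : ℝ) : ℂ)) :=
    (ball_subset_ball (min_le_left _ _)).trans hεU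
  have hzero := Literature.Analysis.Complex.SCV.eqOn_zero_of_eq_zero_on_reals_pi₂ hUc hΦU hρ hsub
    (fun w hw => h0 w (by
      rw [mem_ball, dist_eq_norm]
      exact (norm_sub_le_norm_ofReal_sub w x₀).trans_lt (hw.trans_le (min_le_right _ _))))
  simpa using hzero (hCU (mem_image_of_mem _ hx))

end Summit.QuantumFields.YangMills.Theorems.OSLegsAtWeakCouplingC
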